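import Summits.AnomalousDissipation.AnomalousDissipation.Theorems.PumpedMirrorMirrorFloorTGSmallEnergy

/-!
# `PumpedMirror.MirrorCertificateTG` (stmt-AnomalousDissipation-15371): the common level `E` is pinned
# away from the settled small-energy regime — negative / tightness lemmas (refuter target vetting)

The target `MirrorCertificateTG = ∃ E ε₀ ν₀, ∀ ν < ν₀, A(E,ν) ∧ B(E,ν)` couples the mirror floor `A` and the
bounded mirror family from rest `B` at ONE energy level `E`. The work balance along any global
Leray–Hopf trajectory of `NS_ν(f_TG)` whose `H`-lift stays in the ball `‖U t‖² ≤ E` (`t ≥ 0`) — the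
Cesàro mean of `⟨F_ν(U t), f_TG⟩ = ¼ − 12π²ν (U t, f_TG) + I_{f_TG}(U t)` tends to `0`
(`IsGlobalLerayHopf.tendsto_timeMean_generator` at the work functional, whose differential IS `f_TG` on the
ball), while `|I_{f_TG}(u)| ≤ C_TG |u|²` and `|(u, f_TG)| ≤ ½|u|` — gives

* `quarter_le_of_ball` : `¼ ≤ C_TG · E + ν · M · √E` (any datum, any viscosity, no symmetry used);
* `exists_level_pos` : hence ONE `E⋆ > 0` with `E⋆ ≤ E` for every such trajectory at every `ν ≤ 1`;
* `ball_fails_of_lt` : and for every level with `C_TG · E < ¼` NO such trajectory exists once `ν < ν⋆(E)`.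

The second conjunct of the target's matrix (and crux `MirrorBoundedFromRestTG`) is literally this
hypothesis set with `u₀ = 0` plus K-symmetry, so the target's level obeys `C_TG E ≥ ¼ − o(1)` as `ν → 0`:
by hand `C_TG^{opt} = sup_x ‖sym ∇f_TG(x)‖_{op} ∈ [2π, 2√2 π]`, i.e. `E ≥ 1/(8√2 π) ≈ 0.028`, whereas the
SETTLED part of the floor `A` (`PumpedMirrorMirrorFloorTG.mirrorFloorTG_smallEnergy`, the ν-free work-functional
certificate) reaches only `E ≤ 1/(16(C_TG+1)) ≤ 1/(16(4π+1)) ≈ 0.0046`. So the target is NOT settled by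
the known certificate: its floor must be certified at a level where the work functional is defeated by
Reynolds-stress anti-pumping (`antiPumping_tg`). This quantifies the route's own "why it might fail"
(the two halves pull apart) without refuting anything. Refuter seat
`refuter-rattack-stmt-AnomalousDissipation-15371-0`, 2026-08-17.
-/

set_option linter.dupNamespace false

noncomputable section

namespace Summit.AnomalousDissipation.AnomalousDissipation.Theorems.MirrorCertificateTG.Negative

open MeasureTheory Filter Topology Set
open scoped ENNReal NNReal
open Literature.Analysis.FunctionSpaces Literature.Analysis.FluidPDE
open Summit.AnomalousDissipation.AnomalousDissipation.Theorems.TaylorGreenLoudGalerkinStates.Negative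
  (tgForce isSmooth_tgForce isDivFree_tgForce hasZeroMean_tgForce integral_norm_sq_tgForce)
open Summit.AnomalousDissipation.AnomalousDissipation.Theorems.TaylorCertificatesFloorCertificate
  (eigenforce_exists_workTest eigenforce_nsGeneratorPairing_self)
open Summit.AnomalousDissipation.AnomalousDissipation.Theorems.PumpedMirrorMirrorFloorTG
  (laplacian_tgForce_apply exists_abs_inertialPairing_tg_le)

/-- **Work balance in a ball.** There are constants `C, M ≥ 0` (`C = C_TG` bounds the Reynolds stress
against `f_TG` by the energy, `M = 12π²‖f_TG‖₂ = 6π²`) such that every global Leray–Hopf solution of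
`NS_ν(f_TG)` (any datum) with an `H`-lift confined to the ball `‖U t‖² ≤ E` for all `t ≥ 0` satisfies
`¼ ≤ C E + ν M √E`. [folklore] -/
theorem quarter_le_of_ball :
    ∃ C M : ℝ, 0 ≤ C ∧ 0 ≤ M ∧
      ∀ (ν E : ℝ) (u₀ : UnitAddTorus (Fin 3) → EuclideanSpace ℝ (Fin 3))
        (u : ℝ → UnitAddTorus (Fin 3) → EuclideanSpace ℝ (Fin 3)) (U : ℝ → Torus.energySpace (Fin 3)),
        0 < ν → Torus.IsGlobalLerayHopf ν (fun _ => tgForce) u₀ u →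
        (∀ t, 0 ≤ t → ((U t : Lp (EuclideanSpace ℝ (Fin 3)) 2 (volume : Measure (UnitAddTorus (Fin 3)))) :
            UnitAddTorus (Fin 3) → EuclideanSpace ℝ (Fin 3)) =ᵐ[volume] u t) →
        (∀ t, 0 ≤ t → ‖U t‖ ^ 2 ≤ E) →
        4⁻¹ ≤ C * E + ν * M * Real.sqrt E := by
  obtain ⟨C, hC0, hC⟩ := exists_abs_inertialPairing_tg_le
  have hfL2 : MemLp tgForce 2 (volume : Measure (UnitAddTorus (Fin 3))) := isSmooth_tgForce.memLp 2
  set M₀ : ℝ := ‖hfL2.toLp tgForce‖ with hM₀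
  have hM₀0 : 0 ≤ M₀ := norm_nonneg _
  refine ⟨C, 12 * Real.pi ^ 2 * M₀, hC0, by positivity, ?_⟩
  intro ν E u₀ u U hν hLH hl hbd
  have hE0 : 0 ≤ E := le_trans (sq_nonneg _) (hbd 0 le_rfl)
  obtain ⟨Φ, hΦ⟩ := eigenforce_exists_workTest E isSmooth_tgForce isDivFree_tgForce hasZeroMean_tgForce
  set G : ℝ → ℝ := fun t => Torus.nsGeneratorPairing ν tgForce (U t) (Φ.grad (U t)) with hG
  have hlim : Tendsto (timeMean G) atTop (𝓝 0) := hLH.tendsto_timeMean_generator hfL2 hl Φ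
  set c : ℝ := 4⁻¹ - (C * E + ν * (12 * Real.pi ^ 2 * M₀) * Real.sqrt E) with hc
  -- pointwise lower bound of the generator at the work functional inside the ball
  have hpt : ∀ t, 0 ≤ t → c ≤ G t := by
    intro t ht
    have hgrad := hΦ (U t) (hbd t ht)
    simp only [hG]
    rw [hgrad, eigenforce_nsGeneratorPairing_self ν (12 * Real.pi ^ 2) laplacian_tgForce_apply (U t),
      integral_norm_sq_tgForce]
    have hI : |Torus.inertialPairing (U t).1 tgForce| ≤ C * E :=
      (hC (U t)).trans (mul_le_mul_of_nonneg_left (hbd t ht) hC0)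
    have hP : |Torus.pairing (U t).1 tgForce| ≤ Real.sqrt E * M₀ := by
      refine (Torus.abs_pairing_coe_le hfL2 (U t)).trans (mul_le_mul_of_nonneg_right ?_ hM₀0)
      rw [← Real.sqrt_sq (norm_nonneg (U t))]
      exact Real.sqrt_le_sqrt (hbd t ht)
    have hI' := (abs_le.1 hI).1
    have hP' := (abs_le.1 hP).2
    have hνπ : 0 ≤ ν * (12 * Real.pi ^ 2) := by positivity
    have h3 : -(ν * (12 * Real.pi ^ 2 * M₀) * Real.sqrt E) ≤ ν * (-(12 * Real.pi ^ 2) * Torus.pairing (U t).1 tgForce) := by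
      have := mul_le_mul_of_nonneg_left hP' hνπ
      nlinarith
    simp only [hc]
    linarith
  by_contra hcon
  have hcpos : 0 < c := by simp only [hc]; linarith [not_le.1 hcon]
  -- Cesàro means over `(0, T]` inherit the pointwise bound
  have hmean : ∀ T, 0 < T → c ≤ timeMean G T := by
    intro T hT
    have hGi : IntervalIntegrable G volume 0 T := by
      refine ⟨hLH.integrableOn_generator hfL2 hl Φ hT, ?_⟩
      rw [Ioc_eq_empty (not_lt.2 hT.le)]
      exact integrableOn_empty
    have hle := intervalIntegral.integral_mono_on hT.le intervalIntegrable_const hGi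
      (fun t ht => hpt t ht.1)
    rw [intervalIntegral.integral_const, sub_zero, smul_eq_mul] at hle
    unfold timeMean
    rw [le_inv_mul_iff₀ hT]
    linarith
  have hev : ∀ᶠ T in atTop, timeMean G T < c := hlim.eventually (Iio_mem_nhds hcpos)
  obtain ⟨T, hT1, hT2⟩ := (hev.and (eventually_gt_atTop 0)).exists
  exact (lt_irrefl c) ((hmean T hT2).trans_lt hT1)

/-- **A uniform positive level.** ONE constant `E⋆ > 0` lies below the level of every global
Leray–Hopf trajectory of `NS_ν(f_TG)`, `0 < ν ≤ 1` (any datum), whose `H`-lift stays in a ball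
`‖U t‖² ≤ E`, `t ≥ 0`: `E⋆ ≤ E`. In particular the level `E` of `MirrorBoundedFromRestTG` / of the target
`MirrorCertificateTG` is `≥ E⋆`. [folklore] -/
theorem exists_level_pos :
    ∃ Es : ℝ, 0 < Es ∧
      ∀ (ν E : ℝ) (u₀ : UnitAddTorus (Fin 3) → EuclideanSpace ℝ (Fin 3))
        (u : ℝ → UnitAddTorus (Fin 3) → EuclideanSpace ℝ (Fin 3)) (U : ℝ → Torus.energySpace (Fin 3)),
        0 < ν → ν ≤ 1 → Torus.IsGlobalLerayHopf ν (fun _ => tgForce) u₀ u →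
        (∀ t, 0 ≤ t → ((U t : Lp (EuclideanSpace ℝ (Fin 3)) 2 (volume : Measure (UnitAddTorus (Fin 3)))) :
            UnitAddTorus (Fin 3) → EuclideanSpace ℝ (Fin 3)) =ᵐ[volume] u t) →
        (∀ t, 0 ≤ t → ‖U t‖ ^ 2 ≤ E) → Es ≤ E := by
  obtain ⟨C, M, hC, hM, h⟩ := quarter_le_of_ball
  refine ⟨(min 1 (1 / (4 * (C + M + 1)))) ^ 2, by positivity, ?_⟩
  intro ν E u₀ u U hν hν1 hLH hl hbd
  have hE0 : 0 ≤ E := le_trans (sq_nonneg _) (hbd 0 le_rfl)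
  have hq := h ν E u₀ u U hν hLH hl hbd
  have hmin0 : 0 ≤ min 1 (1 / (4 * (C + M + 1))) := le_min zero_le_one (by positivity)
  by_cases hE1 : 1 ≤ E
  · calc (min 1 (1 / (4 * (C + M + 1)))) ^ 2 ≤ (1 : ℝ) ^ 2 :=
          pow_le_pow_left₀ hmin0 (min_le_left _ _) 2
      _ ≤ E := by simpa using hE1
  · have hE1' : E ≤ 1 := (not_le.1 hE1).le
    have hsq : E ≤ Real.sqrt E := by
      calc E = Real.sqrt (E ^ 2) := (Real.sqrt_sq hE0).symm
        _ ≤ Real.sqrt E := Real.sqrt_le_sqrt (by nlinarith)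
    have hs0 : 0 ≤ Real.sqrt E := Real.sqrt_nonneg E
    have h1 : 4⁻¹ ≤ (C + M + 1) * Real.sqrt E := by
      have hCE : C * E ≤ C * Real.sqrt E := mul_le_mul_of_nonneg_left hsq hC
      have hνM : ν * M * Real.sqrt E ≤ M * Real.sqrt E := by
        have : ν * M ≤ M := by nlinarith
        exact mul_le_mul_of_nonneg_right this hs0
      nlinarith
    have h2 : 1 / (4 * (C + M + 1)) ≤ Real.sqrt E := by
      rw [div_le_iff₀ (by positivity)]
      linarith
    calc (min 1 (1 / (4 * (C + M + 1)))) ^ 2 ≤ (1 / (4 * (C + M + 1))) ^ 2 :=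
          pow_le_pow_left₀ hmin0 (min_le_right _ _) 2
      _ ≤ (Real.sqrt E) ^ 2 := pow_le_pow_left₀ (by positivity) h2 2
      _ = E := Real.sq_sqrt hE0

/-- **Below `¼/C_TG` the ball is eventually impossible.** For every level `E` with `C_TG · E < ¼`
there is `ν⋆(E) > 0` such that for `0 < ν < ν⋆` NO global Leray–Hopf trajectory of `NS_ν(f_TG)` (any
datum) has an `H`-lift confined to `‖U t‖² ≤ E`, `t ≥ 0`: the second conjunct of the target fails at such
a level for every small viscosity, so `MirrorCertificateTG` can only hold with `C_TG · E ≥ ¼`. [folklore] -/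
theorem ball_fails_of_lt :
    ∃ C : ℝ, 0 ≤ C ∧ ∀ E : ℝ, C * E < 4⁻¹ → ∃ νs : ℝ, 0 < νs ∧ ∀ ν : ℝ, 0 < ν → ν < νs →
      ∀ (u₀ : UnitAddTorus (Fin 3) → EuclideanSpace ℝ (Fin 3))
        (u : ℝ → UnitAddTorus (Fin 3) → EuclideanSpace ℝ (Fin 3)) (U : ℝ → Torus.energySpace (Fin 3)),
        Torus.IsGlobalLerayHopf ν (fun _ => tgForce) u₀ u →
        (∀ t, 0 ≤ t → ((U t : Lp (EuclideanSpace ℝ (Fin 3)) 2 (volume : Measure (UnitAddTorus (Fin 3)))) :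
            UnitAddTorus (Fin 3) → EuclideanSpace ℝ (Fin 3)) =ᵐ[volume] u t) →
        ¬ (∀ t, 0 ≤ t → ‖U t‖ ^ 2 ≤ E) := by
  obtain ⟨C, M, hC, hM, h⟩ := quarter_le_of_ball
  refine ⟨C, hC, fun E hE => ?_⟩
  set δ : ℝ := 4⁻¹ - C * E with hδ
  have hδ0 : 0 < δ := by simp only [hδ]; linarith
  refine ⟨δ / (M * Real.sqrt E + 1), by positivity, fun ν hν hνs u₀ u U hLH hl hbd => ?_⟩
  have hq := h ν E u₀ u U hν hLH hl hbd
  have hs0 : 0 ≤ M * Real.sqrt E := by positivity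
  have h1 : ν * (M * Real.sqrt E + 1) < δ := by
    rwa [lt_div_iff₀ (by positivity)] at hνs
  have h2 : ν * M * Real.sqrt E ≤ ν * (M * Real.sqrt E + 1) := by nlinarith
  simp only [hδ] at h1
  linarith

end Summit.AnomalousDissipation.AnomalousDissipation.Theorems.MirrorCertificateTG.Negative

end
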